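import Literature.Computability.Complexity.EquivalenceProblems
import Literature.Computability.Complexity.IndexAllBricks
import Literature.Computability.Complexity.PlumbingBricks
import Literature.Computability.Complexity.HardLangMachine
import Literature.Computability.Complexity.LengthCompare
import Literature.Computability.Complexity.StringEquality
import HarnessLib

/-!
# Fortnow–Grochow 2011, Thm. 4.3 (second half): `CF = PEq ⟹ UP ⊆ RP` — the proof

Discharge (`fortnowGrochow_CF_eq_PEq_UP_subset_RP_holds`) of the named fact
`fortnowGrochow_CF_eq_PEq_UP_subset_RP : PEq ⊆ CFFP → UP ⊆ RP` of `EquivalenceProblems.lean`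
(Fortnow–Grochow, *Complexity classes of equivalence problems revisited*, Inform. Comput. 209
(2011) = arXiv:0907.4775, Thm. 4.3: "If `CF = PEq` then `UP ⊆ RP`"), following the printed proof
step by step (namespace `FortnowGrochowUP`; the objects of the proof are passed to the lemmas as
variables with their defining equivalences `hE`, `hA`, so that this file declares theorems only):

1. For `L ∈ UP` with verifier `L' ∈ P` and witness bound `p` (the tree's `UP`: `x ∈ L ↔ ∃ y,
   |y| ≤ p |x| ∧ ⟨x, y⟩ ∈ L'`, witness sets subsingletons), the printed relation
   `R_L = {((a,x),(a,y)) : x = y or |x| = |y| and V(a, x ⊕ y) = 1}` is the relation `E` of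
   hypothesis `hE`, with `V(a, w) := |w| ≤ p |a| ∧ ⟨a, w⟩ ∈ L'` and `⊕ = GF2Str.xorStr`; every other
   string is related only to itself. It is an equivalence relation (`equivalence`; transitivity
   is where the uniqueness of `UP` witnesses enters) and "clearly `R_L ∈ PEq`" (`relLang_mem_P`):
   its recognition problem is a Boolean combination of equations between `FP` bricks and
   preimages of `LenEq X`, `LenLe p`, `L'` under `FP` bricks (`relLang_eq_setOf`).
2. The hypothesis `PEq ⊆ CF(FP)` gives a canonical form `c ∈ FP`; on a pair `⟨a, x⟩` it returns
   `⟨a, x⟩` itself or `⟨a, X⟩` with `X ⊕ x` the witness of `a` (`canon_shape`).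
3. The printed algorithm "for each length `ℓ ≤ p(|a|)` pick `x ∈ {0,1}^ℓ` at random, compute
   `f((a, x)) = (a, y)` and `V(a, x ⊕ y)`; output 1 if some length accepts" is the `rp P` verdict
   language `A = {⟨a, r⟩ | ∃ j < |⟨a, r⟩|, ⟨a, x ⊕ snd (c ⟨a, x⟩)⟩ ∈ L' for x = r ↾ j}` of
   hypothesis `hA` (the coins, of length `p |a|`, are truncated to each length; running over all
   `j < |⟨a, r⟩| ⊇ {0, …, p |a|}` instead of `j ≤ p |a|` is harmless), in `P` by the index-all loop
   `Brick.ballLen_mem_P`, `Plumb.takeFn`, the xor brick `HardLangM.xorF` and closure of `P` under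
   complement and preimages (`acc_mem_P`).
4. "If `a ∉ L` the algorithm always returns 0" (`not_test_of_not_mem`); "if `a ∈ L` … correct
   with probability `1/2`" (`test_or_test_xor`: of `x` and `x ⊕ w` at the witness length at least
   one accepts — both when `w = 0^ℓ`; and the counting lemma `half_le_uniformProb_take`: a set of
   strings meeting every pair `{x, x ⊕ w}` has density `≥ 1/2`, also after padding the coins).

No new definitions, no new named facts.

## References

* L. Fortnow, J. A. Grochow, *Complexity classes of equivalence problems revisited*, Inform.
  Comput. 209 (2011) 748–763 = arXiv:0907.4775, Thm. 4.3 and its proof [FortnowGrochow2011].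
* S. Arora, B. Barak, *Computational Complexity: A Modern Approach*, CUP 2009, Def. 7.6 (`RP`),
  §1.3 (closure properties of polynomial time) [AroraBarakCC2009].
-/

namespace Literature.Computability.Complexity

open _root_.Computability Polynomial Brick GF2Str

namespace FortnowGrochowUP

/-! ### Bitwise xor on strings of equal length (`GF2Str.xorStr`) -/

/-- `xorStr` is commutative. [folklore] -/
theorem xorStr_comm : ∀ l l' : List Bool, xorStr l l' = xorStr l' l
  | [], l' => by simp
  | a :: l, [] => by simp
  | a :: l, b :: l' => by rw [xorStr_cons, xorStr_cons, xorStr_comm l l', Bool.xor_comm]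

/-- `x ⊕ x = 0^{|x|}`. [folklore] -/
theorem xorStr_self : ∀ l : List Bool, xorStr l l = List.replicate l.length false
  | [] => rfl
  | a :: l => by rw [xorStr_cons, Bool.xor_self, xorStr_self l]; rfl

/-- `x ⊕ (x ⊕ w) = w` when `|x| = |w|`. [folklore] -/
theorem xorStr_xorStr_cancel : ∀ x w : List Bool, x.length = w.length → xorStr x (xorStr x w) = w
  | [], [], _ => rfl
  | [], _ :: _, h => by simp at h
  | _ :: _, [], h => by simp at h
  | a :: x, b :: w, h => by
    rw [xorStr_cons, xorStr_cons, xorStr_xorStr_cancel x w (by simpa using h)]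
    cases a <;> cases b <;> rfl

/-- Right cancellation: `x ⊕ y = z ⊕ y → x = z` for strings of the common length `|y|`.
[folklore] -/
theorem xorStr_right_cancel : ∀ y x z : List Bool, x.length = y.length → z.length = y.length →
    xorStr x y = xorStr z y → x = z
  | [], [], [], _, _, _ => rfl
  | [], _ :: _, _, hx, _, _ => by simp at hx
  | [], [], _ :: _, _, hz, _ => by simp at hz
  | _ :: _, [], _, hx, _, _ => by simp at hx
  | _ :: _, _ :: _, [], _, hz, _ => by simp at hz
  | b :: y, a :: x, c :: z, hx, hz, h => by
    simp only [xorStr_cons, List.cons.injEq] at h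
    obtain ⟨h1, h2⟩ := h
    have hac : a = c := by cases a <;> cases b <;> cases c <;> simp at h1 ⊢
    rw [hac, xorStr_right_cancel y x z (by simpa using hx) (by simpa using hz) h2]

/-! ### Languages: membership, Boolean combinations in `P` -/

/-- Membership in a set-builder language (the `Language` instance of `∈` on `setOf`; the
`Language` copy of `Set.mem_setOf_eq`). [folklore] -/
theorem mem_setOf_lang {P : List Bool → Prop} {w : List Bool} :
    @Membership.mem (List Bool) (Language Bool) Language.instMembershipList (setOf P) w ↔ P w :=
  Iff.rfl

/-- Membership in the complement of a language (the `Language` copy of `Set.mem_compl_iff`).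
[folklore] -/
theorem mem_compl_lang {A : Language Bool} {w : List Bool} : w ∈ Aᶜ ↔ w ∉ A :=
  Iff.rfl

/-- Transport of `P`-membership along an extensional description. [folklore] -/
theorem mem_P_congr {A B : Language Bool} (hA : A ∈ Classes.P) (h : ∀ w, w ∈ B ↔ w ∈ A) :
    B ∈ Classes.P := by
  rw [show B = A from Set.ext h]
  exact hA

/-- `P` is closed under conjunction of membership predicates (`inter_mem_P`). [Arora–Barak 2009,
§1.3] [cite: AroraBarakCC2009, §1.3] -/
theorem setOf_and_mem_P {P Q : List Bool → Prop} (hP : ({w | P w} : Language Bool) ∈ Classes.P)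
    (hQ : ({w | Q w} : Language Bool) ∈ Classes.P) :
    ({w | P w ∧ Q w} : Language Bool) ∈ Classes.P :=
  mem_P_congr (inter_mem_P hP hQ) fun _ => Iff.rfl

/-- `P` is closed under disjunction of membership predicates (`union_mem_P`). [Arora–Barak 2009,
§1.3] [cite: AroraBarakCC2009, §1.3] -/
theorem setOf_or_mem_P {P Q : List Bool → Prop} (hP : ({w | P w} : Language Bool) ∈ Classes.P)
    (hQ : ({w | Q w} : Language Bool) ∈ Classes.P) :
    ({w | P w ∨ Q w} : Language Bool) ∈ Classes.P :=
  mem_P_congr (union_mem_P hP hQ) fun _ => Iff.rfl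

/-- A preimage of a `P` language under an `FP` brick, as a membership predicate
(`preimage_mem_P`, applied form). [Arora–Barak 2009, Thm. 2.8 (proof)]
[cite: AroraBarakCC2009, Thm. 2.8 (proof)] -/
theorem setOf_apply_mem_mem_P {A : Language Bool} (hA : A ∈ Classes.P) {g : List Bool → List Bool}
    (hg : g ∈ FP) : ({w | g w ∈ A} : Language Bool) ∈ Classes.P :=
  preimage_mem_P hA hg

/-- `sndF ∘ fstF`, `fstF ∘ fstF`, … : composites of bricks are in `FP` (applied form of
`comp_mem_FP`). [folklore] -/
theorem comp_proj_mem_FP {f g : List Bool → List Bool} (hf : f ∈ FP) (hg : g ∈ FP) :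
    (fun w => f (g w)) ∈ FP :=
  comp_mem_FP hf hg

/-! ### The counting lemma -/

/-- `1/2 ≤ F / 2^m` from `2^m ≤ 2 F`. [folklore] -/
theorem half_le_div_two_pow {m F : ℕ} (h : 2 ^ m ≤ 2 * F) : (1 / 2 : ℝ) ≤ (F : ℝ) / 2 ^ m := by
  rw [le_div_iff₀ (by positivity)]
  have h' : ((2 ^ m : ℕ) : ℝ) ≤ ((2 * F : ℕ) : ℝ) := by exact_mod_cast h
  push_cast at h'
  linarith

/-- A finite set of coin strings meeting every pair `{r, φ r}` of an injection `φ` has at least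
half the mass: `2^m ≤ 2 |F|`. [folklore] -/
theorem two_pow_le_two_mul_card {m : ℕ} (F : Finset (List.Vector Bool m))
    (φ : List.Vector Bool m → List.Vector Bool m) (hφ : Function.Injective φ)
    (h : ∀ r, r ∈ F ∨ φ r ∈ F) : 2 ^ m ≤ 2 * F.card := by
  classical
  set G : Finset (List.Vector Bool m) := Finset.univ.filter fun r => φ r ∈ F with hG
  have hGF : G.card ≤ F.card := by
    calc G.card = (G.image φ).card := (Finset.card_image_of_injective G hφ).symm
      _ ≤ F.card := Finset.card_le_card fun s hs => by
          obtain ⟨r, hr, rfl⟩ := Finset.mem_image.1 hs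
          exact (Finset.mem_filter.1 hr).2
  have hcov : (Finset.univ : Finset (List.Vector Bool m)) ⊆ F ∪ G := fun r _ => by
    rcases h r with hr | hr
    · exact Finset.mem_union_left _ hr
    · exact Finset.mem_union_right _ (Finset.mem_filter.2 ⟨Finset.mem_univ _, hr⟩)
  have := (Finset.card_le_card hcov).trans (Finset.card_union_le F G)
  rw [Finset.card_univ, card_vector, Fintype.card_bool] at this
  omega

/-- **The counting lemma**: if `|w| = ℓ ≤ m` and a set `S` of strings contains, for every `x` of
length `ℓ`, `x` or `x ⊕ w`, then a uniformly random `r ∈ {0,1}^m` has `r ↾ ℓ ∈ S` with probability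
`≥ 1/2` (the translation `r ↦ r ⊕ w0^{m-ℓ}` is an injection of `{0,1}^m` commuting with the prefix
map, and `{0,1}^m ⊆ F ∪ φ⁻¹ F`). [Fortnow–Grochow 2011, proof of Thm. 4.3 ("the answer is correct
with probability `1/2`")] [cite: FortnowGrochow2011, Thm. 4.3 (proof)] -/
theorem half_le_uniformProb_take {m ℓ : ℕ} (hℓ : ℓ ≤ m) {w : List Bool} (hw : w.length = ℓ)
    {S : Set (List Bool)} (hS : ∀ x : List Bool, x.length = ℓ → x ∈ S ∨ xorStr x w ∈ S) :
    (1 / 2 : ℝ) ≤ uniformProb m {r | r.take ℓ ∈ S} := by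
  classical
  -- the padded mask `W = w 0^{m-ℓ}` and the translation `φ r = r ⊕ W` of `{0,1}^m`
  set W : List Bool := w ++ List.replicate (m - ℓ) false with hW
  have hWlen : W.length = m := by
    rw [hW, List.length_append, List.length_replicate, hw]
    omega
  have hWtake : W.take ℓ = w := by
    rw [hW, List.take_append_of_le_length hw.ge, List.take_of_length_le hw.le]
  let φ : List.Vector Bool m → List.Vector Bool m := fun r =>
    ⟨xorStr r.toList W, by rw [length_xorStr, r.toList_length, hWlen, max_self]⟩
  have hφ : Function.Injective φ := by
    intro r r' hrr'
    have hval : xorStr r.toList W = xorStr r'.toList W := congrArg List.Vector.toList hrr'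
    exact List.Vector.toList_injective (xorStr_right_cancel W _ _
      (by rw [r.toList_length, hWlen]) (by rw [r'.toList_length, hWlen]) hval)
  unfold uniformProb
  refine half_le_div_two_pow (two_pow_le_two_mul_card _ φ hφ fun r => ?_)
  simp only [Finset.mem_filter, Finset.mem_univ, true_and, Set.mem_setOf_eq]
  have hx : (r.toList.take ℓ).length = ℓ := by
    rw [List.length_take, r.toList_length]
    omega
  rcases hS _ hx with h | h
  · exact Or.inl h
  · refine Or.inr ?_
    show (xorStr r.toList W).take ℓ ∈ S
    rwa [xorStr_take, hWtake]

/-! ### The relation `R_L` of the printed proof -/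

section Relation

variable {L' : Language Bool} {p : Polynomial ℕ} {E : List Bool → List Bool → Prop}
  (hE : ∀ u v, E u v ↔ (u = v ∨ ∃ a x y : List Bool, u = boolPair a x ∧ v = boolPair a y ∧
    y.length = x.length ∧ x.length ≤ p.eval a.length ∧ boolPair a (xorStr x y) ∈ L'))

include hE

/-- **`R_L` is an equivalence relation** (for a `UP` verifier `(L', p)`: `E` is Fortnow–Grochow's
`R_L = {((a, x), (a, y)) : x = y or |x| = |y| and V(a, x ⊕ y) = 1}` with
`V(a, w) := |w| ≤ p |a| ∧ ⟨a, w⟩ ∈ L'`, extended by equality to all strings). Reflexivity and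
symmetry (`x ⊕ y = y ⊕ x`) are plain; transitivity uses the uniqueness of witnesses: if `x ⊕ y`
and `y ⊕ z` are both the witness of `a` then `x = z`. [Fortnow–Grochow 2011, proof of Thm. 4.3]
[cite: FortnowGrochow2011, Thm. 4.3 (proof)] -/
theorem equivalence
    (huniq : ∀ a : List Bool,
      ({y | y.length ≤ p.eval a.length ∧ boolPair a y ∈ L'} : Set (List Bool)).Subsingleton) :
    Equivalence E := by
  refine ⟨fun u => (hE u u).2 (Or.inl rfl), fun h => ?_, fun h₁ h₂ => ?_⟩
  · rcases (hE _ _).1 h with rfl | ⟨a, x, y, rfl, rfl, hyx, hx, hmem⟩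
    · exact (hE _ _).2 (Or.inl rfl)
    · exact (hE _ _).2
        (Or.inr ⟨a, y, x, rfl, rfl, hyx.symm, hyx.le.trans hx, by rwa [xorStr_comm]⟩)
  · rcases (hE _ _).1 h₁ with rfl | ⟨a, x, y, rfl, rfl, hyx, hx, hxy⟩
    · exact h₂
    rcases (hE _ _).1 h₂ with rfl | ⟨a', y', z, hv, rfl, hzy, hy, hyz⟩
    · exact h₁
    obtain ⟨rfl, rfl⟩ : a = a' ∧ y = y' := by
      simpa using boolPair_injective (a₁ := (a, y)) (a₂ := (a', y')) hv
    have h1 : xorStr x y ∈ ({y | y.length ≤ p.eval a.length ∧ boolPair a y ∈ L'} : Set _) :=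
      ⟨by rw [length_xorStr, hyx, max_self]; exact hx, hxy⟩
    have h2 : xorStr y z ∈ ({y | y.length ≤ p.eval a.length ∧ boolPair a y ∈ L'} : Set _) :=
      ⟨by rw [length_xorStr, hzy, max_self]; exact hy, hyz⟩
    have heq : xorStr x y = xorStr z y := by rw [huniq a h1 h2, xorStr_comm]
    rw [xorStr_right_cancel y x z hyx.symm hzy heq]
    exact (hE _ _).2 (Or.inl rfl)

/-- **The recognition problem of `R_L`, described in polynomial-time terms** on a string `w`
(read as `w = ⟨u, v⟩`, `u = ⟨a, x⟩`, `v = ⟨a', y⟩` through the projections `fstF`/`sndF`): `w` is a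
pair, and either `u = v`, or `u`, `v` are pairs with `a = a'`, `|y| = |x| ≤ p |a|` and
`⟨a, x ⊕ y⟩ ∈ L'`. [Fortnow–Grochow 2011, proof of Thm. 4.3 ("Clearly `R_L ∈ PEq`")]
[cite: FortnowGrochow2011, Thm. 4.3 (proof)] -/
theorem relLang_eq_setOf :
    relLang E =
      {w | boolPair (fstF w) (sndF w) = w ∧
        (fstF w = sndF w ∨
          (boolPair (fstF (fstF w)) (sndF (fstF w)) = fstF w ∧
            boolPair (fstF (sndF w)) (sndF (sndF w)) = sndF w ∧
            fstF (fstF w) = fstF (sndF w) ∧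
            (sndF (sndF w)).length = (sndF (fstF w)).length ∧
            (sndF (fstF w)).length ≤ p.eval (fstF (fstF w)).length ∧
            boolPair (fstF (fstF w)) (xorStr (sndF (fstF w)) (sndF (sndF w))) ∈ L'))} := by
  ext w
  constructor
  · rintro ⟨u, v, rfl, huv⟩
    refine ⟨by rw [fstF_boolPair, sndF_boolPair], ?_⟩
    rcases (hE _ _).1 huv with rfl | ⟨a, x, y, rfl, rfl, hyx, hx, hmem⟩
    · exact Or.inl (by rw [fstF_boolPair, sndF_boolPair])
    · refine Or.inr ?_
      simp only [fstF_boolPair, sndF_boolPair, true_and]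
      exact ⟨hyx, hx, hmem⟩
  · rintro ⟨hw, h⟩
    refine ⟨fstF w, sndF w, hw.symm, (hE _ _).2 ?_⟩
    rcases h with h | ⟨hu, hv, ha, hyx, hx, hmem⟩
    · exact Or.inl h
    · refine Or.inr ⟨fstF (fstF w), sndF (fstF w), sndF (sndF w), hu.symm, ?_, hyx, hx, hmem⟩
      rw [ha]
      exact hv.symm

/-- **"Clearly `R_L ∈ PEq`"**: the recognition problem of `R_L` is in `P` — each clause of
`relLang_eq_setOf` is an equation between `FP` bricks (`fstF`, `sndF`, `fanoutFn`, the xor brick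
`HardLangM.xorF`) or the preimage under such a brick of `LenEq X` (equal lengths), `LenLe p` (the
witness bound) or `L' ∈ P`. [Fortnow–Grochow 2011, proof of Thm. 4.3]
[cite: FortnowGrochow2011, Thm. 4.3 (proof)] -/
theorem relLang_mem_P (hL' : L' ∈ Classes.P) : relLang E ∈ Classes.P := by
  have hff : (fun w => fstF (fstF w)) ∈ FP := comp_proj_mem_FP fstF_mem_FP fstF_mem_FP
  have hsf : (fun w => sndF (fstF w)) ∈ FP := comp_proj_mem_FP sndF_mem_FP fstF_mem_FP
  have hfs : (fun w => fstF (sndF w)) ∈ FP := comp_proj_mem_FP fstF_mem_FP sndF_mem_FP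
  have hss : (fun w => sndF (sndF w)) ∈ FP := comp_proj_mem_FP sndF_mem_FP sndF_mem_FP
  rw [relLang_eq_setOf hE]
  refine setOf_and_mem_P ?_ (setOf_or_mem_P (setOf_apply_eq_apply_mem_P fstF_mem_FP sndF_mem_FP)
    (setOf_and_mem_P ?_ (setOf_and_mem_P ?_ (setOf_and_mem_P (setOf_apply_eq_apply_mem_P hff hfs)
      (setOf_and_mem_P ?_ (setOf_and_mem_P ?_ ?_))))))
  · -- `w` is a pair: `⟨fstF w, sndF w⟩ = w`
    exact mem_P_congr (setOf_apply_eq_apply_mem_P (fanoutFn_mem_FP fstF_mem_FP sndF_mem_FP)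
      OracleCompose.id_mem_FP) fun w => by simp
  · -- `u` is a pair
    exact mem_P_congr (setOf_apply_eq_apply_mem_P
      (comp_mem_FP (fanoutFn_mem_FP fstF_mem_FP sndF_mem_FP) fstF_mem_FP) fstF_mem_FP)
      fun w => by simp
  · -- `v` is a pair
    exact mem_P_congr (setOf_apply_eq_apply_mem_P
      (comp_mem_FP (fanoutFn_mem_FP fstF_mem_FP sndF_mem_FP) sndF_mem_FP) sndF_mem_FP)
      fun w => by simp
  · -- `|y| = |x|`: preimage of `LenEq X` under `w ↦ ⟨x, y⟩`
    exact mem_P_congr (setOf_apply_mem_mem_P (LenEq_mem_P X) (fanoutFn_mem_FP hsf hss))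
      fun w => by simp
  · -- `|x| ≤ p |a|`: preimage of `LenLe p` under `w ↦ ⟨a, x⟩`
    exact mem_P_congr (setOf_apply_mem_mem_P (LenLe_mem_P p) (fanoutFn_mem_FP hff hsf))
      fun w => by simp
  · -- `⟨a, x ⊕ y⟩ ∈ L'`: preimage of `L'` under `w ↦ ⟨a, xorF ⟨x, y⟩⟩`
    exact mem_P_congr (setOf_apply_mem_mem_P hL'
      (fanoutFn_mem_FP hff (comp_mem_FP HardLangM.xorF_mem_FP (fanoutFn_mem_FP hsf hss))))
      fun w => by simp [HardLangM.xorF_apply]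

/-- **`R_L ∈ PEq`** for a `UP` verifier `(L', p)` with `L' ∈ P`. [Fortnow–Grochow 2011, proof
of Thm. 4.3] [cite: FortnowGrochow2011, Thm. 4.3 (proof)] -/
theorem mem_PEq (hL' : L' ∈ Classes.P)
    (huniq : ∀ a : List Bool,
      ({y | y.length ≤ p.eval a.length ∧ boolPair a y ∈ L'} : Set (List Bool)).Subsingleton) :
    E ∈ PEq :=
  ⟨equivalence hE huniq, relLang_mem_P hE hL'⟩

/-! ### The canonical form on pairs `⟨a, x⟩`, and the test `⟨a, x ⊕ snd (c ⟨a, x⟩)⟩ ∈ L'` -/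

/-- **Shape of a canonical form of `R_L` on `⟨a, x⟩`**: it is `⟨a, x⟩` itself, or `⟨a, X⟩` with
`|X| = |x|` and `X ⊕ x` a witness of `a` ("for all distinct `x`, `x'`, `f_a(x) = f_a(x')` iff
`x ⊕ x' = w_a`"). [Fortnow–Grochow 2011, proof of Thm. 4.3]
[cite: FortnowGrochow2011, Thm. 4.3 (proof)] -/
theorem canon_shape {c : List Bool → List Bool} (hc : IsCanonicalFormFor E c) (a x : List Bool) :
    c (boolPair a x) = boolPair a x ∨
      ∃ X : List Bool, c (boolPair a x) = boolPair a X ∧ x.length = X.length ∧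
        (xorStr X x).length ≤ p.eval a.length ∧ boolPair a (xorStr X x) ∈ L' := by
  rcases (hE _ _).1 (hc.1 (boolPair a x)) with h | ⟨a', X, x', h1, h2, hlen, hle, hmem⟩
  · exact Or.inl h
  · obtain ⟨rfl, rfl⟩ : a = a' ∧ x = x' := by
      simpa using boolPair_injective (a₁ := (a, x)) (a₂ := (a', x')) h2
    exact Or.inr ⟨X, h1, hlen, by rw [length_xorStr, hlen, max_self]; exact hle, hmem⟩

/-- **No false positives**: if `a ∉ L` then no `x` with `|x| ≤ p |a|` passes the printed test
"compute `f((a, x)) = (a, y)` and `V(a, x ⊕ y)`" (the class of `⟨a, x⟩` is a singleton, so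
`c ⟨a, x⟩ = ⟨a, x⟩` and the test asks whether `0^{|x|}` is a witness).
[Fortnow–Grochow 2011, proof of Thm. 4.3 ("If `a ∉ L` then this algorithm always returns 0")]
[cite: FortnowGrochow2011, Thm. 4.3 (proof)] -/
theorem not_test_of_not_mem {c : List Bool → List Bool} (hc : IsCanonicalFormFor E c)
    {a : List Bool} (ha : ¬ ∃ y, y.length ≤ p.eval a.length ∧ boolPair a y ∈ L') {x : List Bool}
    (hx : x.length ≤ p.eval a.length) : boolPair a (xorStr x (sndF (c (boolPair a x)))) ∉ L' := by
  intro ht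
  rcases canon_shape hE hc a x with h | ⟨X, -, -, hX⟩
  · rw [h, sndF_boolPair, xorStr_self] at ht
    exact ha ⟨_, by simpa using hx, ht⟩
  · exact ha ⟨_, hX.1, hX.2⟩

/-- **The pairing at the witness length**: if `w` is the witness of `a` then for every `x` with
`|x| = |w|`, `x` or `x ⊕ w` passes the test (if `c` fixes `⟨a, x⟩` then `c ⟨a, x ⊕ w⟩ = ⟨a, x⟩` and
the test at `x ⊕ w` computes `(x ⊕ w) ⊕ x = w`; otherwise `c ⟨a, x⟩ = ⟨a, X⟩` with `X ⊕ x = w`).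
This covers both printed cases "`0^ℓ` is `a`'s witness: always 1" and "`y ≠ x`: correct with
probability `1/2`". [Fortnow–Grochow 2011, proof of Thm. 4.3]
[cite: FortnowGrochow2011, Thm. 4.3 (proof)] -/
theorem test_or_test_xor
    (huniq : ∀ a : List Bool,
      ({y | y.length ≤ p.eval a.length ∧ boolPair a y ∈ L'} : Set (List Bool)).Subsingleton)
    {c : List Bool → List Bool} (hc : IsCanonicalFormFor E c) {a w : List Bool}
    (hw : w.length ≤ p.eval a.length ∧ boolPair a w ∈ L') {x : List Bool}
    (hx : x.length = w.length) :
    boolPair a (xorStr x (sndF (c (boolPair a x)))) ∈ L' ∨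
      boolPair a (xorStr (xorStr x w) (sndF (c (boolPair a (xorStr x w))))) ∈ L' := by
  rcases canon_shape hE hc a x with h | ⟨X, hcx, -, hX⟩
  · right
    have hrel : E (boolPair a x) (boolPair a (xorStr x w)) :=
      (hE _ _).2 (Or.inr ⟨a, x, xorStr x w, rfl, rfl, by rw [length_xorStr, hx, max_self],
        hx.le.trans hw.1, by rw [xorStr_xorStr_cancel x w hx]; exact hw.2⟩)
    have hc2 : c (boolPair a (xorStr x w)) = boolPair a x := ((hc.2 _ _ hrel).symm).trans h
    rw [hc2, sndF_boolPair, xorStr_comm, xorStr_xorStr_cancel x w hx]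
    exact hw.2
  · left
    rw [hcx, sndF_boolPair, xorStr_comm, huniq a hX hw]
    exact hw.2

/-- **Completeness**: if `a ∈ L` (witness `w`, `|w| ≤ p |a|`) then at least half of the coin
strings `r ∈ {0,1}^{p |a|}` are accepted by the verdict language `A` of the printed algorithm
(hypothesis `hA`: "some prefix `r ↾ j`, `j < |⟨a, r⟩|`, passes the test") — already the round
`j = |w|` accepts whenever `r ↾ |w|` passes the test, which happens with probability `≥ 1/2` by the
pairing and the counting lemma. [Fortnow–Grochow 2011, proof of Thm. 4.3]
[cite: FortnowGrochow2011, Thm. 4.3 (proof)] -/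
theorem half_le_uniformProb_acc
    (huniq : ∀ a : List Bool,
      ({y | y.length ≤ p.eval a.length ∧ boolPair a y ∈ L'} : Set (List Bool)).Subsingleton)
    {c : List Bool → List Bool} (hc : IsCanonicalFormFor E c) {A : Language Bool}
    (hA : ∀ z, z ∈ A ↔ ∃ j < z.length,
      boolPair (fstF z) (xorStr ((sndF z).take j) (sndF (c (boolPair (fstF z) ((sndF z).take j)))))
        ∈ L')
    {a : List Bool} (ha : ∃ y, y.length ≤ p.eval a.length ∧ boolPair a y ∈ L') :
    1 / 2 ≤ uniformProb (p.eval a.length) {r | boolPair a r ∈ A} := by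
  obtain ⟨w, hw⟩ := ha
  have h1 := half_le_uniformProb_take hw.1 rfl
    (S := {x | boolPair a (xorStr x (sndF (c (boolPair a x)))) ∈ L'})
    fun x hx => test_or_test_xor hE huniq hc hw hx
  -- monotonicity of `uniformProb` along the implication `r ↾ |w| ∈ S → ⟨a, r⟩ ∈ A` on `{0,1}^m`
  have hmono : ∀ r : List Bool, r.length = p.eval a.length →
      r ∈ ({r | r.take w.length ∈
        ({x | boolPair a (xorStr x (sndF (c (boolPair a x)))) ∈ L'} : Set (List Bool))} :
          Set (List Bool)) → r ∈ ({r | boolPair a r ∈ A} : Set (List Bool)) := by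
    intro r hr hrS
    refine (hA _).2 ⟨w.length, ?_, ?_⟩
    · rw [length_boolPair]
      omega
    · simpa using hrS
  refine h1.trans ?_
  classical
  unfold uniformProb
  refine div_le_div_of_nonneg_right ?_ (by positivity)
  exact_mod_cast Finset.card_le_card fun r hr => by
    simp only [Finset.mem_filter, Finset.mem_univ, true_and] at hr ⊢
    exact hmono _ r.toList_length hr

end Relation

/-! ### The verdict language of the algorithm is in `P` -/

/-- **The verdict language is in `P`** (`c ∈ FP`, `L' ∈ P`). The loop body — the test at the prefix
`x = r ↾ j` on indexed records `⟨⟨a, r⟩, 1ʲ⟩` — is the preimage of `L'` under the brick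
`v ↦ ⟨a, xorF ⟨x, snd (c ⟨a, x⟩)⟩⟩` (`Plumb.takeFn`, `fanoutFn`, `HardLangM.xorF`), and the bounded
search over the lengths is the complement of the index-all loop (`Brick.ballLen_mem_P`) of its
complement. [Fortnow–Grochow 2011, proof of Thm. 4.3 ("decides `L` in polynomial time");
Arora–Barak 2009, §1.3 (bounded loops)] [cite: FortnowGrochow2011, Thm. 4.3 (proof)] -/
theorem acc_mem_P {L' : Language Bool} {c : List Bool → List Bool} {A : Language Bool}
    (hA : ∀ z, z ∈ A ↔ ∃ j < z.length,
      boolPair (fstF z) (xorStr ((sndF z).take j) (sndF (c (boolPair (fstF z) ((sndF z).take j)))))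
        ∈ L')
    (hL' : L' ∈ Classes.P) (hc : c ∈ FP) : A ∈ Classes.P := by
  -- the loop body `T` on indexed records `v = ⟨⟨a, r⟩, 1ʲ⟩`
  obtain ⟨T, hT⟩ : ∃ T : Language Bool, ∀ v, v ∈ T ↔
      boolPair (fstF (fstF v)) (xorStr ((sndF (fstF v)).take (sndF v).length)
        (sndF (c (boolPair (fstF (fstF v)) ((sndF (fstF v)).take (sndF v).length))))) ∈ L' :=
    ⟨setOf _, fun _ => Iff.rfl⟩
  have hff : (fun w => fstF (fstF w)) ∈ FP := comp_proj_mem_FP fstF_mem_FP fstF_mem_FP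
  have hpre : (Plumb.takeFn ∘ fanoutFn sndF fun v => sndF (fstF v)) ∈ FP :=
    comp_mem_FP Plumb.takeFn_mem_FP
      (fanoutFn_mem_FP sndF_mem_FP (comp_proj_mem_FP sndF_mem_FP fstF_mem_FP))
  have hY : (fun v => sndF (c (fanoutFn (fun w => fstF (fstF w))
      (Plumb.takeFn ∘ fanoutFn sndF fun v => sndF (fstF v)) v))) ∈ FP :=
    comp_mem_FP sndF_mem_FP (comp_mem_FP hc (fanoutFn_mem_FP hff hpre))
  have hTP : T ∈ Classes.P := by
    refine mem_P_congr (setOf_apply_mem_mem_P hL'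
      (fanoutFn_mem_FP hff (comp_mem_FP HardLangM.xorF_mem_FP (fanoutFn_mem_FP hpre hY))))
      fun v => ?_
    rw [hT]
    simp [HardLangM.xorF_apply, mem_setOf_lang]
  have hB := Brick.ballLen_mem_P (compl_mem_P_iff.2 hTP)
  refine mem_P_congr (compl_mem_P_iff.2 hB) fun z => ?_
  rw [hA, mem_compl_lang, mem_setOf_lang]
  simp only [mem_compl_lang, hT, fstF_boolPair, sndF_boolPair, List.length_replicate]
  push Not
  rfl

end FortnowGrochowUP

open FortnowGrochowUP in
/-- **Discharge of `fortnowGrochow_CF_eq_PEq_UP_subset_RP`** (Fortnow–Grochow 2011, Thm. 4.3,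
second half: "If `CF = PEq` then `UP ⊆ RP`"), by the printed proof: for `L ∈ UP` with verifier
`(L', p)` the relation `R_L` is in `PEq`, hence — under `PEq ⊆ CF(FP)` — has a canonical form
`c ∈ FP`; the randomized polynomial-time algorithm "pick `x` of each length at random, compute
`c ⟨a, x⟩ = ⟨a, y⟩`, accept if `V(a, x ⊕ y)`" (verdict language `A ∈ P`, coins of length `p |a|`)
never accepts when `a ∉ L` and accepts with probability `≥ 1/2` when `a ∈ L`, i.e. witnesses
`L ∈ rp P = RP`. [cite: FortnowGrochow2011, Thm. 4.3] -/
theorem fortnowGrochow_CF_eq_PEq_UP_subset_RP_holds : fortnowGrochow_CF_eq_PEq_UP_subset_RP := by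
  intro hCF L hL
  obtain ⟨L', hL'P, p, hLiff, huniq⟩ := hL
  -- the relation `R_L`
  obtain ⟨E, hE⟩ : ∃ E : List Bool → List Bool → Prop, ∀ u v, E u v ↔
      (u = v ∨ ∃ a x y : List Bool, u = boolPair a x ∧ v = boolPair a y ∧
        y.length = x.length ∧ x.length ≤ p.eval a.length ∧ boolPair a (xorStr x y) ∈ L') :=
    ⟨_, fun _ _ => Iff.rfl⟩
  -- its canonical form
  obtain ⟨-, c, hcFP, hc⟩ := hCF (mem_PEq hE hL'P huniq)
  -- the verdict language of the algorithm
  obtain ⟨A, hA⟩ : ∃ A : Language Bool, ∀ z, z ∈ A ↔ ∃ j < z.length,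
      boolPair (fstF z) (xorStr ((sndF z).take j) (sndF (c (boolPair (fstF z) ((sndF z).take j)))))
        ∈ L' :=
    ⟨setOf _, fun _ => Iff.rfl⟩
  refine ⟨A, acc_mem_P hA hL'P hcFP, p, fun a => ⟨fun ha => ?_, fun ha r hr hmem => ?_⟩⟩
  · exact half_le_uniformProb_acc hE huniq hc hA ((hLiff a).1 ha)
  · obtain ⟨j, -, ht⟩ := (hA _).1 hmem
    rw [fstF_boolPair, sndF_boolPair] at ht
    exact not_test_of_not_mem hE hc (fun h => ha ((hLiff a).2 h))
      ((List.take_sublist j r).length_le.trans hr.le) ht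

end Literature.Computability.Complexity
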